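import Mathlib
import HarnessLib
import Literature.AlgebraicGeometry.Kloosterman2025.ExcessTangentDimensionLowerBound

/-!
# HodgeLocusCensusExcessLowerBound833 — the Kloosterman lower bound `e ≥ 2` on census cell (8,3,3), for every hypersurface of the cell and every λ (cell pub-hlocus, ENGINE B seat ivhs-2, gen 20)
HONEST FRAMING: certified instances and evidence bearing on the general Hodge conjecture; no claim.

The cell-specific EVALUATION of the tree's general inequality
`Literature.AlgebraicGeometry.Kloosterman2025.twoPlanes_finrank_inf_add_ciHilbert_le` / `twoPlanes_idealDegree_inf_lt`
(Kloosterman 2025, Theorem 1.3 / Example 3.16, lower bound) for the census cell (8,3,3): cubic eightfolds (`d = 3`) through two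
`4`-planes in `ℙ⁹` meeting in a `3`-PLANE (`k = 4`, `c = 1`, `r = 4`; Movasati's setting `m = n/2 − 1`); `h_{I₁+I₂} = ciHilbert(2,2,2,2)`,
`(α, β) = (3, 2)`: `h(2) = 6 > h(3) = 4`, so for EVERY `F` in normal form with finite-dimensional Jacobian ring, every socle functional `ℓ`
and EVERY `c₀`: `dim (I₁∩I₂)₃ + 2 ≤ dim I(ℓ₁ + c₀ℓ₂)₃` (excess tangent dimension `e(X; c₀) ≥ 2`, the tangent thickness `b = 2` of the cell)
and in particular `(I₁ ∩ I₂)₃ ⊊ I(ℓ₁ + c₀ℓ₂)₃`.  The cell is not a row of the tree's `census_cells_bounds`; the arithmetic and the corollaries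
are recorded here, in the style of `HodgeLocusCensusExcessLowerBound832` / `…451632`.  This is the LOWER-BOUND input of the census record
`pub-hlocus-ivhs-2/MU0831-631-g20.md` for cell (8,3,3) (`μ₀(8,3,3; λ) ≥ 1 + b = 3`).

What is NOT formalised here is exactly what is not formalised in the Literature file (the identification of these graded
pieces with tangent spaces of Noether–Lefschetz / Hodge loci, cited there), and the census UPPER bounds (certificates of the records).
-/

noncomputable section

open MvPolynomial Module Literature.RingTheory.MvPolynomial
open Literature.AlgebraicGeometry.HodgeTheory Literature.AlgebraicGeometry.Motives.UniversalHypersurface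
  Literature.AlgebraicGeometry.Kloosterman2023 Literature.AlgebraicGeometry.Kloosterman2025

namespace Summit.HodgeConjecture.HodgeConjecture.HodgeLocus.Census.ExcessLowerBound

variable {K : Type*} [Field K]

/-- The arithmetic of cell (8,3,3): `h_{I₁+I₂} = ciHilbert(2,2,2,2)` takes the values `h(2) = 6`, `h(3) = 4`. -/
theorem ciHilbert_2222_at_2_and_3 :
    ciHilbert (List.replicate 4 2) 2 = 6 ∧ ciHilbert (List.replicate 4 2) 3 = 4 := by
  decide

/-- **Census cell (8,3,3) — two 4-planes in a cubic eightfold meeting in a 3-plane** (`d = 3`, `k = 4`, `c = 1`, `r = 4`;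
`(α, β) = (3, 2)`): for EVERY cubic `F` in Kloosterman's normal form in `x_0,…,x_9` with finite-dimensional Jacobian ring
(witnessed by `xₗ^N ∈ J^F`), every socle functional `ℓ` of `J^F` and EVERY `c₀ ∈ K`,
`(I(Π₁) ∩ I(Π₂))₃ ⊊ I(ℓ₁ + c₀ℓ₂)₃` (evaluation of Kloosterman 2025, Theorem 1.3 at `(d, c, k) = (3, 1, 4)`). -/
theorem cubicEightfold_twoFourPlanes_threePlane_idealDegree_inf_lt (κ : Fin 1 ⊕ Fin 4 ≃ Fin (4 + 1))
    (gA h : Fin 1 → MvPolynomial (Fin (2 * 4 + 2)) K) (gC : Fin 4 → MvPolynomial (Fin (2 * 4 + 2)) K)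
    (Q : Fin 1 → Fin 1 → MvPolynomial (Fin (2 * 4 + 2)) K) (P : Fin 4 → MvPolynomial (Fin (2 * 4 + 2)) K)
    (hgA : ∀ i, (gA i).IsHomogeneous 1) (hh : ∀ j, (h j).IsHomogeneous 1) (hgC : ∀ m, (gC m).IsHomogeneous 1)
    (hQ : ∀ i j, (Q i j).IsHomogeneous 1) (hP : ∀ m, (P m).IsHomogeneous 2) {N : ℕ} (hN : 0 < N)
    (hXN : ∀ l, (X l : MvPolynomial (Fin (2 * 4 + 2)) K) ^ N ∈ jacobianIdeal (twoPlanesForm gA h gC Q P))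
    {ℓ : MvPolynomial (Fin (2 * 4 + 2)) K →ₗ[K] K} (hℓ : ∀ p, ℓ (homogeneousComponent 10 p) = ℓ p)
    (hJ : annIdeal ℓ = jacobianIdeal (twoPlanesForm gA h gC Q P)) (c₀ : K) :
    idealDegree
        ((Ideal.span (Set.range (plane₁Gens κ gA gC)) ⊔ Ideal.span (Set.range (plane₁Cofs κ h Q P))) ⊓
          (Ideal.span (Set.range (plane₂Gens κ h gC)) ⊔ Ideal.span (Set.range (plane₂Cofs κ gA Q P)))) 3 <
      idealDegree (annIdeal (ciCycleFunctional ℓ (plane₁Gens κ gA gC) (plane₁Cofs κ h Q P) +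
        c₀ • ciCycleFunctional ℓ (plane₂Gens κ h gC) (plane₂Cofs κ gA Q P))) 3 :=
  twoPlanes_idealDegree_inf_lt (d := 3) (by norm_num) κ gA h gC Q P hgA hh hgC hQ hP hN hXN hℓ hJ
    (α := 3) (β := 2) (by norm_num) (by decide) c₀

/-- **Census cell (8,3,3), quantitative form**: `dim (I(Π₁) ∩ I(Π₂))₃ + 2 ≤ dim ker` of the graded multiplication form of
`ℓ₁ + c₀ℓ₂` on `S₃ × S₂`, i.e. excess tangent dimension `e(X; c₀) ≥ 2 = h(2) − h(3)` for every `X` of the cell and every `c₀`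
(Kloosterman 2025, Theorem 1.3 / Example 3.16 at `(d, c, k) = (3, 1, 4)`; the census's tangent thickness `b = 2`). -/
theorem cubicEightfold_twoFourPlanes_threePlane_finrank_inf_add_two_le (κ : Fin 1 ⊕ Fin 4 ≃ Fin (4 + 1))
    (gA h : Fin 1 → MvPolynomial (Fin (2 * 4 + 2)) K) (gC : Fin 4 → MvPolynomial (Fin (2 * 4 + 2)) K)
    (Q : Fin 1 → Fin 1 → MvPolynomial (Fin (2 * 4 + 2)) K) (P : Fin 4 → MvPolynomial (Fin (2 * 4 + 2)) K)
    (hgA : ∀ i, (gA i).IsHomogeneous 1) (hh : ∀ j, (h j).IsHomogeneous 1) (hgC : ∀ m, (gC m).IsHomogeneous 1)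
    (hQ : ∀ i j, (Q i j).IsHomogeneous 1) (hP : ∀ m, (P m).IsHomogeneous 2) {N : ℕ} (hN : 0 < N)
    (hXN : ∀ l, (X l : MvPolynomial (Fin (2 * 4 + 2)) K) ^ N ∈ jacobianIdeal (twoPlanesForm gA h gC Q P))
    {ℓ : MvPolynomial (Fin (2 * 4 + 2)) K →ₗ[K] K} (hℓ : ∀ p, ℓ (homogeneousComponent 10 p) = ℓ p)
    (hJ : annIdeal ℓ = jacobianIdeal (twoPlanesForm gA h gC Q P)) (c₀ : K) :
    finrank K (idealDegree
        ((Ideal.span (Set.range (plane₁Gens κ gA gC)) ⊔ Ideal.span (Set.range (plane₁Cofs κ h Q P))) ⊓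
          (Ideal.span (Set.range (plane₂Gens κ h gC)) ⊔ Ideal.span (Set.range (plane₂Cofs κ gA Q P)))) 3) + 2 ≤
      finrank K (LinearMap.ker (gradedMulForm
        (ciCycleFunctional ℓ (plane₁Gens κ gA gC) (plane₁Cofs κ h Q P) +
          c₀ • ciCycleFunctional ℓ (plane₂Gens κ h gC) (plane₂Cofs κ gA Q P)) 3 2)) := by
  have h0 := twoPlanes_finrank_inf_add_ciHilbert_le (d := 3) (by norm_num) κ gA h gC Q P hgA hh hgC hQ hP hN hXN
    hℓ hJ (α := 3) (β := 2) (by norm_num) c₀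
  have h1 : ciHilbert (List.replicate 4 (3 - 1)) 2 = 6 := by decide
  have h2 : ciHilbert (List.replicate 4 (3 - 1)) 3 = 4 := by decide
  rw [h1, h2] at h0
  omega

end Summit.HodgeConjecture.HodgeConjecture.HodgeLocus.Census.ExcessLowerBound
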